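import Mathlib
import HarnessLib
import Summits.HubbardSuperconductivity.HubbardSuperconductivity.Theses.KLProgramme
import Summits.HubbardSuperconductivity.HubbardSuperconductivity.Theorems.KLProgrammeKLRegimeSplitGlueV11P4

/-!
# Route `KLProgramme` — closer of the K3 glue item `KLRegimeTwoPointLimitGlueV11` (stmt-HubbardSuperconductivity-19828)

Cell gate-hubbard-kl, seat hubbard-kl-k3c2-p3 (g0).  The route file's gen-3 glue statement
`KLRegimeEngineV11 → KLRegimeBetaSplitV11 → KLRegimeCountertermV11 → KLRegimeVolumeLimitV11 → KLRegimeTwoPointAssemblyV11 → KLRegimeTwoPointLimit`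
(K3 resplit rev 13; children = `EngineP4 / BetaSplitP / CountertermP2 klPredsV11 klWindowC`,
`VolumeLimitP2 / TwoPointAssemblyP3 klPredsV11 FinalTwoLegVolLimit klWindowC` by definition) IS the glued strong induction
`…KLRegimeSplit.KLRegimeInductionV11P4 = KLRegimeInductionP4 klPredsV11 FinalTwoLegVolLimit` (p463614,
`KLProgrammeKLRegimeSplitGlueV11P4.lean`): the children unfold definitionally.  One line; nothing new is asserted.
-/

namespace Summit.HubbardSuperconductivity.HubbardSuperconductivity.Theorems

set_option linter.dupNamespace false -- summit = problem name (single-conjunct summit), D-0017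

/-- **The gen-3 K3 glue holds**: the five V11 children of the split imply `KLRegimeTwoPointLimit`
(by `KLRegimeSplit.KLRegimeInductionV11P4`). -/
theorem klRegimeTwoPointLimitGlueV11_proof :
    Summit.HubbardSuperconductivity.HubbardSuperconductivity.Theses.KLProgramme.KLRegimeTwoPointLimitGlueV11 :=
  fun h₁ h₂ h₃ h₄ h₅ => KLRegimeSplit.KLRegimeInductionV11P4 h₁ h₂ h₃ h₄ h₅

end Summit.HubbardSuperconductivity.HubbardSuperconductivity.Theorems
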